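import Literature.Barriers.Parity.SiegelZeroDichotomyChowlaStep1
import Literature.Barriers.Parity.SiegelZeroDichotomyChowlaStep3
import Literature.Barriers.Parity.SiegelZeroDichotomyChowlaStep5
import HarnessLib

/-!
# `TaoTeravainen2021_chowla` from its three classical inputs

Topic `Literature/Barriers/Parity`; top of the proof DAG of the named fact
`Literature.Barriers.Parity.TaoTeravainen2021_chowla` (Tao–Teräväinen 2022, Corollary 1.8 (ii) =
Theorem 1.6 at `k = 0`; `SiegelZeroDichotomy.lean`, `SiegelZeroDichotomyChowla.lean`). PROVED:

* `TaoTeravainen2021_chowla_of_inputs` — Corollary 1.8 (ii) follows from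
  (a) Proposition 3.5, (3.13)–(3.14) (sparsity of exceptional primes at a Siegel zero:
      `Literature.NumberTheory.LFunctions.SiegelZero.TaoTeravainen2021_eq313`, `…_eq314`),
  (b) Lemma 3.7 at `k = 0` (Weil bound for character sums with polynomial argument plus completion
      of sums: `TaoTeravainen2021_lemma37_k0`), and
  (c) Lemma 6.1 (the majorant of `λ♭_Siegel`: `TaoTeravainen2021_lemma61`),
  all three being NAMED FACTS of the source; everything else in the printed proof — the chain (1.5),
  step (i) (Proposition 4.2, via Corollary 3.6), step (iii) (Proposition 6.3) and step (v)
  (Proposition 8.1, the case `ℓ > 0`) at `k = 0`, with the bookkeeping of §2.1–§2.4 and Siegel's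
  theorem (1.4) (proved in this tree) — is proved in the files
  `SiegelZeroDichotomyChowla{,Model,Tools,Step1,TypeI,DivisorSums,Step5,Majorant,Step3}.lean` and
  `Literature/NumberTheory/LFunctions/SiegelZeroExceptionalPrimes.lean`.
  [cite: TaoTeravainen2021, Corollary 1.8 (ii), Theorem 1.6, §1.2 (1.5), Propositions 3.5, 4.2, 6.3, 8.1, Lemmas 3.7, 6.1]

The discharge `TaoTeravainen2021_chowla_holds` is thereby reduced to discharging these three facts.
-/

noncomputable section

namespace Literature.Barriers.Parity

open Literature.NumberTheory.LFunctions.SiegelZero (TaoTeravainen2021_eq313 TaoTeravainen2021_eq314)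

/-- **Corollary 1.8 (ii) from Proposition 3.5, Lemma 3.7 (`k = 0`) and Lemma 6.1.**
[cite: TaoTeravainen2021, Corollary 1.8 (ii) (proof: Theorem 1.6 via (1.5) and Propositions 4.2, 6.3, 8.1)] -/
theorem TaoTeravainen2021_chowla_of_inputs (h₁ : TaoTeravainen2021_eq313)
    (h₂ : TaoTeravainen2021_eq314) (h₃ : TaoTeravainen2021_lemma37_k0)
    (h₄ : TaoTeravainen2021_lemma61) : TaoTeravainen2021_chowla :=
  TaoTeravainen2021_chowla_of_steps (TaoTeravainen2021_prop42_k0_of_prop35 h₁ h₂)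
    (TaoTeravainen2021_prop63_k0_of_lemma61 h₄) (TaoTeravainen2021_prop81_k0_of_lemma37 h₃)

end Literature.Barriers.Parity
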